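import Summits.QuantumFields.BalabanUV.Beta.D1BFx.WardJetsFromNoether

/-!
# `BalabanUV.Beta.D1BFx.WardJetsSources` — road «BF-x» for binder row D1, slot (K), identity side: **«WARD-L WITH SOURCES»** (owner ruling
# ρ-g11-7, option (β)), PART 1 (model): the one-sided Ward letters of single-fine-bond background directions CARRY EXPLICIT SOURCES —
# `Kₛ·W₀ + K₀·Wₛ = −(K₀[j,s]·Nt[j,a])_{j,a}`, `Kₛₜ·W₀ + Kₛ·Wₜ + Kₜ·Wₛ + K₀·Wₛₜ = −((Kₜ[j,s] + [j=t]K₀[t,s] + [j=s]K₀[s,t])·Nt[j,a])_{j,a}`,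
# while the constraint letters `Qₛ·W₀ + Q₀·Wₛ = 0`, `Qₛₜ·W₀ + … = 0` stay EXACT — read out of `WardJetsFromNoether`'s packed off-shell Noether
# jets [P1]∕[P2] for generator tables of THE CONVENTION's single-row shape, with the read-out weight `Nt` kept PARAMETRIC (tip ∕ midpoint ∕ any)

HONEST DEPENDENCY (cell records, verbatim): «continuum YM on T⁴ ⇐ BetaPertH ∧ nine spine estimates (0/9 proved); BetaPertH ⇐ (D1) ∧ (D4) ∧
CAP+tail; G-an2-4 gates asym, D1 and NE2/3/4.»  HONEST FRAMING (cell contract, verbatim): «discharging `BetaPertH` makes Bałaban's UV stability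
UNCONDITIONAL — a real constructive-QFT result; it is NOT the continuum limit and NOT the Clay problem.»  THIS MODULE DISCHARGES NOTHING of (K),
of D1 or of the wall: [folklore] finite-dimensional matrix algebra (Mathlib) over leaf-05-g11's `WardJetsFromNoether` (`oslot`, `P1_of_congruence`,
`P2_of_congruence`, `kkt_mul_fromRows_zero`, …) BY NAME, on ABSTRACT data.  No `def`, no `def … : Prop`, nothing cited, 0 sorry; no table of the
cell is instantiated (the road's tori are PART 2, `WardJetsSourcesTorus`).  0 binders discharged; (K) NOT closed; NOT D1, NOT BetaPertH, NOT
continuum, NOT Clay.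

ABSOLUTE RULE (cell charter, verbatim): «No internally-minted statement may enter as a cited fact. Every hypothesis is either kernel-proved in this
package or a verbatim quotation of a PUBLISHED theorem with page reference. The manuscript(s) under audit are NOT citable for their own disputed
steps — they are the thing under adjudication; programme-internal (2001/route/tribunal) claims are never citable.»

WHY (journal: leaf-03-g13 QUESTION l.31874, TOY VERDICT T-d1leaf03g13-WARDL l.32072 = FINDING F-d1leaf03g13-2, owner RULING ρ-g11-7 l.32217).
(A1) `KCombineCovStripped.hessKer_transfer_road_cov_stripped` displays the ONE-SIDED letters `aₛ : kₛ·Ŵ₀ + K̂·Wₛ = 0` (and `aₜ`, `aₛₜ`) for THE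
CONVENTION's gauge jets `Wₛ = Ê_b·N̂` of a SINGLE fine bond.  For such directions the packed Noether jet [P1] of `WardJetsFromNoether`
(`𝕄₁ k·Ŵ₀ + 𝕄₀·X₁ k + oslot X₁ (col_k 𝕄₀) = 0`) carries a NON-ZERO other-slot term: with single-row generator tables `(X₁ k) i a = [i = k]·Nt i a`
one has `oslot X₁ w = (w_j·Nt j a)_{j,a}` on the field rows for EVERY weight `w` (§1), so the honest one-sided letters have the SOURCES displayed in
the title (§2–§3; the toy: `oslotₖ ≠ 0` for 32∕32 bonds).  The multiplier rows of `oslot` vanish identically (generators have no multiplier rows and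
`X₁ (inr m) = 0`), so the CONSTRAINT letters `bₛ bₜ bₛₜ` of (A1) need NO source.  `WardJetsFromNoether.ward₁` is the complementary statement: for
RESPONSE-PACKED (on-shell) directions the sources die on contraction.  The read-out weight `Nt` is a free symbol: THE CONVENTION of record reads
the tip (`Nt j = N̂ ∘ tip`), the group-action (midpoint) read-out is `½(N̂∘tip + N̂∘base)` — Q-WL-2 (an2) decides; §5 turns that question into a
kernel statement (PART 1b `WardJetsSourcesParity`: the sandwich `W₀ᵀ·Kₛ·W₀ = −Tₛ` and its symmetric part under the two read-outs).
CONTENT (all [folklore]):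
* §1 `oslot_singleRow`, `oslot_singleRow₂` — the other-slot read-outs of single-row generator families, any weight.
* §2 **`wardSrc₁`** — [P1] ⟹ `K₁ (inl s)·W₀ + K₀·x₁ (inl s) = −(K₀ j s·Nt j a)` ∧ `Q₁ (inl s)·W₀ + Q₀·x₁ (inl s) = 0`.
* §3 **`wardSrc₂`** — [P2] ⟹ the mixed second letters, K-side with source, Q-side exact (`x₂ s t = [s = t]•x₁ (inl s)`).
* §4 the congruence feed: `G_singleRow`, `G₂_singleRow`, `H_singleRow` (the generator operators of `P1∕P2_of_congruence` under the single-row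
  convention are the block-diagonal weights), `C1_packed_of_blocks` ((C1-K) `Σ_b W₀ b a • K₁ b = −(D_a K₀ + K₀ D_a)`, (C1-Q) `Σ_b W₀ b a • Q₁ b = −Q₀ D_a`,
  `D_a = diagonal (Nt · a)` ⟹ [C1] packed), **`wardSrc₁_of_congruence`**, **`wardSrc₂_of_congruence`** — the sockets «(Sd)∕(Wd) periodised» plug into.
NOT HERE (honest): the parity constraint (PART 1b `WardJetsSourcesParity`), the road's torus instance (PART 2 `WardJetsSourcesTorus`), «(A1) v2 WITH SOURCES» (PART 2d∕2e `SliceTransferDefectWardJet(Mix)` fed with these sources),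
the periodisation of (Sd)∕(Wd), the (A2-M∕N) dictionary, colour.
Unit `b2b-balaban-beta-d1-formalise-leaf-03` (gen 14), D1 formalisation swarm LEAF PROVER 03; road owner `b2b-balaban-beta-d1-p2`.
-/

noncomputable section

namespace Summit.QuantumFields.BalabanUV.Beta.D1BFx.WardJetsSources

open Matrix
open scoped BigOperators
open Literature.MathematicalPhysics.QuantumFieldTheory.Balaban1983to89.Beta.Composition (kkt)
open Summit.QuantumFields.BalabanUV.Beta.D1BFx.WardJetsFromNoether (oslot oslot_apply P1_of_congruence P2_of_congruence
  kkt_mul_fromRows_zero fromRows_eq_zero_iff fromRows_add_fromRows sum_smul_kkt)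

variable {ν μ ρ : Type*}

/-! ## §1 The single-row generator convention: `oslot` read-outs for every weight -/

section SingleRow

variable [Fintype ν] [Fintype μ] [DecidableEq ν] [DecidableEq μ]

/-- [folklore] **THE OTHER-SLOT READ-OUT OF A SINGLE-ROW GENERATOR FAMILY.**  If the packed generator tables are `X₁ k = [x₁ k; 0]` with
`(x₁ k) i a = [inl i = k]·Nt i a` (the table of the field direction `k = inl b` has ONE non-zero row, the row `b`, with the read-out weights
`Nt b`; multiplier directions have no table), then for EVERY weight `w` the field rows of `oslot X₁ w` are `w (inl j)·Nt j a` and its multiplier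
rows vanish. -/
theorem oslot_singleRow (Nt : ν → ρ → ℝ) (x₁ : ν ⊕ μ → Matrix ν ρ ℝ) (hx : ∀ k i a, x₁ k i a = if Sum.inl i = k then Nt i a else 0)
    (w : ν ⊕ μ → ℝ) :
    oslot (fun k => fromRows (x₁ k) (0 : Matrix μ ρ ℝ)) w = fromRows (Matrix.of fun j a => w (Sum.inl j) * Nt j a) (0 : Matrix μ ρ ℝ) := by
  ext j a
  rcases j with j | m
  · rw [oslot_apply, Matrix.fromRows_apply_inl, Matrix.of_apply, Fintype.sum_sum_type]
    simp only [Matrix.fromRows_apply_inl, Matrix.fromRows_apply_inr, Matrix.zero_apply, mul_zero, Finset.sum_const_zero, add_zero, hx,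
      Sum.inl.injEq, mul_ite]
    rw [Finset.sum_ite_eq' Finset.univ j]
    simp
  · rw [oslot_apply, Matrix.fromRows_apply_inr, Matrix.zero_apply, Fintype.sum_sum_type]
    simp only [Matrix.fromRows_apply_inl, Matrix.fromRows_apply_inr, Matrix.zero_apply, mul_zero, Finset.sum_const_zero, add_zero, hx]
    simp

/-- [folklore] **THE ORDER-TWO READ-OUT.**  With THE CONVENTION's second generator tables `X₂ k l = [k = l]•X₁ k` (same-bond second jet = first
jet, cross-bond jets vanish), `oslot (X₂ l) w` keeps only the row `l`: field row `j` = `[inl j = l]·w (inl j)·Nt j a`, multiplier rows `0`. -/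
theorem oslot_singleRow₂ (Nt : ν → ρ → ℝ) (x₁ : ν ⊕ μ → Matrix ν ρ ℝ) (hx : ∀ k i a, x₁ k i a = if Sum.inl i = k then Nt i a else 0)
    (X₂ : ν ⊕ μ → ν ⊕ μ → Matrix (ν ⊕ μ) ρ ℝ) (hX₂ : ∀ k l, X₂ k l = if k = l then fromRows (x₁ k) (0 : Matrix μ ρ ℝ) else 0)
    (l : ν ⊕ μ) (w : ν ⊕ μ → ℝ) :
    oslot (X₂ l) w = fromRows (Matrix.of fun j a => if Sum.inl j = l then w (Sum.inl j) * Nt j a else 0) (0 : Matrix μ ρ ℝ) := by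
  ext j a
  rcases j with j | m
  · rw [oslot_apply, Matrix.fromRows_apply_inl, Matrix.of_apply, hX₂]
    by_cases h : l = Sum.inl j
    · subst h
      rw [if_pos rfl, if_pos rfl]
      have := congrFun (congrFun (oslot_singleRow Nt x₁ hx w) (Sum.inl j)) a
      rw [oslot_apply, Matrix.fromRows_apply_inl, Matrix.of_apply] at this
      exact this
    · rw [if_neg h, if_neg (Ne.symm h)]
      simp
  · rw [oslot_apply, Matrix.fromRows_apply_inr, Matrix.zero_apply, hX₂]
    by_cases h : l = Sum.inr m
    · subst h
      rw [if_pos rfl]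
      have := congrFun (congrFun (oslot_singleRow Nt x₁ hx w) (Sum.inr m)) a
      rw [oslot_apply, Matrix.fromRows_apply_inr, Matrix.zero_apply] at this
      exact this
    · rw [if_neg h]
      simp

omit [Fintype ν] [Fintype μ] in
/-- [folklore] The field rows of THE CONVENTION's second tables: `X₂ (inl s) (inl t) = [x₂ s t; 0]` with `x₂ s t = [s = t]•x₁ (inl s)`. -/
theorem X₂_inl_inl (x₁ : ν ⊕ μ → Matrix ν ρ ℝ) (X₂ : ν ⊕ μ → ν ⊕ μ → Matrix (ν ⊕ μ) ρ ℝ)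
    (hX₂ : ∀ k l, X₂ k l = if k = l then fromRows (x₁ k) (0 : Matrix μ ρ ℝ) else 0) (s t : ν) :
    X₂ (Sum.inl s) (Sum.inl t) = fromRows (if s = t then x₁ (Sum.inl s) else 0) (0 : Matrix μ ρ ℝ) := by
  rw [hX₂]
  by_cases h : s = t
  · subst h; rw [if_pos rfl, if_pos rfl]
  · rw [if_neg (fun e => h (Sum.inl_injective e)), if_neg h, Matrix.fromRows_zero]

end SingleRow

/-! ## §2 Order one: the K-letter carries the source `−(K₀ j s · Nt j a)`, the Q-letter is exact -/

section OrderOne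

variable [Fintype ν] [Fintype μ] [DecidableEq ν] [DecidableEq μ]

/-- [folklore] **«WARD-L WITH SOURCES», ORDER ONE.**  Base tables `K₀`, `Q₀`; partial tables `K₁ k`, `Q₁ k` in every packed direction
`k : ν ⊕ μ`; gauge basis `W₀`; single-row generator tables `x₁` with read-out weights `Nt`.  If the packed off-shell Noether jet [P1] holds in every
direction (the hypothesis of `WardJetsFromNoether.ward₁` VERBATIM), then for every FINE direction `s`:
`K₁ (inl s)·W₀ + K₀·x₁ (inl s) = −(K₀ j s·Nt j a)_{j,a}` (the source `Eₛ = −oslotₛ|_field`) and `Q₁ (inl s)·W₀ + Q₀·x₁ (inl s) = 0` (no source). -/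
theorem wardSrc₁ (K₀ : Matrix ν ν ℝ) (Q₀ : Matrix μ ν ℝ) (K₁ : ν ⊕ μ → Matrix ν ν ℝ) (Q₁ : ν ⊕ μ → Matrix μ ν ℝ) (W₀ : Matrix ν ρ ℝ)
    (Nt : ν → ρ → ℝ) (x₁ : ν ⊕ μ → Matrix ν ρ ℝ) (hx : ∀ k i a, x₁ k i a = if Sum.inl i = k then Nt i a else 0)
    (hP1 : ∀ k, kkt (K₁ k) (Q₁ k) * fromRows W₀ (0 : Matrix μ ρ ℝ) + kkt K₀ Q₀ * fromRows (x₁ k) (0 : Matrix μ ρ ℝ)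
      + oslot (fun j => fromRows (x₁ j) (0 : Matrix μ ρ ℝ)) (fun i => kkt K₀ Q₀ i k) = 0) (s : ν) :
    K₁ (Sum.inl s) * W₀ + K₀ * x₁ (Sum.inl s) = -Matrix.of (fun j a => K₀ j s * Nt j a)
      ∧ Q₁ (Sum.inl s) * W₀ + Q₀ * x₁ (Sum.inl s) = 0 := by
  have h := hP1 (Sum.inl s)
  rw [kkt_mul_fromRows_zero, kkt_mul_fromRows_zero, oslot_singleRow Nt x₁ hx, fromRows_add_fromRows, fromRows_add_fromRows,
    fromRows_eq_zero_iff] at h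
  have hw : (Matrix.of fun j a => kkt K₀ Q₀ (Sum.inl j) (Sum.inl s) * Nt j a) = Matrix.of fun j a => K₀ j s * Nt j a := by
    ext j a
    simp [kkt]
  rw [hw, add_zero] at h
  exact ⟨eq_neg_of_add_eq_zero_left h.1, h.2⟩

/-- [folklore] The MULTIPLIER directions, for the record: [P1] at `k = inr m` reads `K₁ (inr m)·W₀ + K₀·x₁ (inr m) = −(Q₀ m j·Nt j a)_{j,a}` (the
Hessian table of the `m`-th constraint against the gauge basis carries the source `−Q₀ᵀ`-column) and `Q₁ (inr m)·W₀ + Q₀·x₁ (inr m) = 0`. -/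
theorem wardSrc₁_inr (K₀ : Matrix ν ν ℝ) (Q₀ : Matrix μ ν ℝ) (K₁ : ν ⊕ μ → Matrix ν ν ℝ) (Q₁ : ν ⊕ μ → Matrix μ ν ℝ) (W₀ : Matrix ν ρ ℝ)
    (Nt : ν → ρ → ℝ) (x₁ : ν ⊕ μ → Matrix ν ρ ℝ) (hx : ∀ k i a, x₁ k i a = if Sum.inl i = k then Nt i a else 0)
    (hP1 : ∀ k, kkt (K₁ k) (Q₁ k) * fromRows W₀ (0 : Matrix μ ρ ℝ) + kkt K₀ Q₀ * fromRows (x₁ k) (0 : Matrix μ ρ ℝ)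
      + oslot (fun j => fromRows (x₁ j) (0 : Matrix μ ρ ℝ)) (fun i => kkt K₀ Q₀ i k) = 0) (m : μ) :
    K₁ (Sum.inr m) * W₀ + K₀ * x₁ (Sum.inr m) = -Matrix.of (fun j a => Q₀ m j * Nt j a)
      ∧ Q₁ (Sum.inr m) * W₀ + Q₀ * x₁ (Sum.inr m) = 0 := by
  have h := hP1 (Sum.inr m)
  rw [kkt_mul_fromRows_zero, kkt_mul_fromRows_zero, oslot_singleRow Nt x₁ hx, fromRows_add_fromRows, fromRows_add_fromRows,
    fromRows_eq_zero_iff] at h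
  have hw : (Matrix.of fun j a => kkt K₀ Q₀ (Sum.inl j) (Sum.inr m) * Nt j a) = Matrix.of fun j a => Q₀ m j * Nt j a := by
    ext j a
    simp [kkt]
  rw [hw, add_zero] at h
  exact ⟨eq_neg_of_add_eq_zero_left h.1, h.2⟩

end OrderOne

/-! ## §3 Order two: the mixed K-letter carries `−((K₁ t j s + [j=t]K₀ t s + [j=s]K₀ s t)·Nt j a)`, the Q-letter is exact -/

section OrderTwo

variable [Fintype ν] [Fintype μ] [DecidableEq ν] [DecidableEq μ]

/-- [folklore] **«WARD-L WITH SOURCES», ORDER TWO (mixed; `s = t` included).**  Packed second tables `𝕄₂` with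
`𝕄₂ (inl s) (inl t) = kkt (K₂ s t) (Q₂ s t)` on the fine pairs, THE CONVENTION's second generator tables `X₂ k l = [k = l]•[x₁ k; 0]`.  If the packed
second Noether jet [P2] of `WardJetsFromNoether` holds for every pair of directions, then for all fine `s t`:
`K₂ s t·W₀ + K₁ (inl s)·x₁ (inl t) + K₁ (inl t)·x₁ (inl s) + K₀·x₂ s t = −((K₁ (inl t) j s + [j = t]·K₀ t s + [j = s]·K₀ s t)·Nt j a)_{j,a}`,
`x₂ s t = [s = t]•x₁ (inl s)`, and the Q-twin `Q₂ s t·W₀ + Q₁ (inl s)·x₁ (inl t) + Q₁ (inl t)·x₁ (inl s) + Q₀·x₂ s t = 0`. -/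
theorem wardSrc₂ (K₀ : Matrix ν ν ℝ) (Q₀ : Matrix μ ν ℝ) (K₁ : ν ⊕ μ → Matrix ν ν ℝ) (Q₁ : ν ⊕ μ → Matrix μ ν ℝ)
    (K₂ : ν → ν → Matrix ν ν ℝ) (Q₂ : ν → ν → Matrix μ ν ℝ) (W₀ : Matrix ν ρ ℝ)
    (Nt : ν → ρ → ℝ) (x₁ : ν ⊕ μ → Matrix ν ρ ℝ) (hx : ∀ k i a, x₁ k i a = if Sum.inl i = k then Nt i a else 0)
    (𝕄₂ : ν ⊕ μ → ν ⊕ μ → Matrix (ν ⊕ μ) (ν ⊕ μ) ℝ) (h𝕄₂ : ∀ s t : ν, 𝕄₂ (Sum.inl s) (Sum.inl t) = kkt (K₂ s t) (Q₂ s t))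
    (X₂ : ν ⊕ μ → ν ⊕ μ → Matrix (ν ⊕ μ) ρ ℝ) (hX₂ : ∀ k l, X₂ k l = if k = l then fromRows (x₁ k) (0 : Matrix μ ρ ℝ) else 0)
    (hP2 : ∀ k l, 𝕄₂ k l * fromRows W₀ (0 : Matrix μ ρ ℝ) + kkt (K₁ k) (Q₁ k) * fromRows (x₁ l) (0 : Matrix μ ρ ℝ)
      + kkt (K₁ l) (Q₁ l) * fromRows (x₁ k) (0 : Matrix μ ρ ℝ) + kkt K₀ Q₀ * X₂ k l
      + oslot (fun j => fromRows (x₁ j) (0 : Matrix μ ρ ℝ)) (fun i => kkt (K₁ l) (Q₁ l) i k)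
      + oslot (X₂ l) (fun i => kkt K₀ Q₀ i k) + oslot (X₂ k) (fun i => kkt K₀ Q₀ i l) = 0) (s t : ν) :
    K₂ s t * W₀ + K₁ (Sum.inl s) * x₁ (Sum.inl t) + K₁ (Sum.inl t) * x₁ (Sum.inl s) + K₀ * (if s = t then x₁ (Sum.inl s) else 0)
        = -Matrix.of (fun j a => (K₁ (Sum.inl t) j s + (if j = t then K₀ t s else 0) + (if j = s then K₀ s t else 0)) * Nt j a)
      ∧ Q₂ s t * W₀ + Q₁ (Sum.inl s) * x₁ (Sum.inl t) + Q₁ (Sum.inl t) * x₁ (Sum.inl s) + Q₀ * (if s = t then x₁ (Sum.inl s) else 0) = 0 := by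
  have h := hP2 (Sum.inl s) (Sum.inl t)
  rw [h𝕄₂, X₂_inl_inl x₁ X₂ hX₂, kkt_mul_fromRows_zero, kkt_mul_fromRows_zero, kkt_mul_fromRows_zero, kkt_mul_fromRows_zero,
    oslot_singleRow Nt x₁ hx, oslot_singleRow₂ Nt x₁ hx X₂ hX₂, oslot_singleRow₂ Nt x₁ hx X₂ hX₂] at h
  simp only [fromRows_add_fromRows] at h
  rw [fromRows_eq_zero_iff] at h
  obtain ⟨h1, h2⟩ := h
  refine ⟨?_, by simpa using h2⟩
  rw [add_assoc, add_assoc] at h1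
  rw [eq_neg_of_add_eq_zero_left h1]
  congr 1
  ext j a
  simp only [Matrix.add_apply, Matrix.of_apply, kkt, Matrix.fromBlocks_apply₁₁, Sum.inl.injEq]
  by_cases hjt : j = t
  · subst hjt
    by_cases hjs : j = s
    · subst hjs; simp only [if_true]; ring
    · simp only [if_true, if_neg hjs]; ring
  · by_cases hjs : j = s
    · subst hjs; simp only [if_true, if_neg hjt]; ring
    · simp only [if_neg hjs, if_neg hjt]; ring

end OrderTwo

/-! ## §4 The congruence feed: [C1]∕[C2] under the single-row convention ⟹ [P1]∕[P2] ⟹ the letters with sources -/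

section Congruence

variable [Fintype ν] [Fintype μ] [DecidableEq ν] [DecidableEq μ]

omit [Fintype ν] [Fintype μ] in
/-- [folklore] **THE GENERATOR OPERATOR OF THE SINGLE-ROW CONVENTION** is block-diagonal: `G a = fromBlocks (diagonal (Nt · a)) 0 0 0`
satisfies `P1_of_congruence`'s `hG : G a l k = X₁ k l a`. -/
theorem G_singleRow (Nt : ν → ρ → ℝ) (x₁ : ν ⊕ μ → Matrix ν ρ ℝ) (hx : ∀ k i a, x₁ k i a = if Sum.inl i = k then Nt i a else 0)
    (a : ρ) (l k : ν ⊕ μ) :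
    (Matrix.fromBlocks (Matrix.diagonal fun i : ν => Nt i a) 0 0 (0 : Matrix μ μ ℝ)) l k = (fromRows (x₁ k) (0 : Matrix μ ρ ℝ)) l a := by
  rcases l with l | m <;> rcases k with k | m'
  · rw [Matrix.fromBlocks_apply₁₁, Matrix.fromRows_apply_inl, hx, Matrix.diagonal_apply]
    simp only [Sum.inl.injEq]
  · rw [Matrix.fromBlocks_apply₁₂, Matrix.fromRows_apply_inl, hx, Matrix.zero_apply]
    simp
  · rw [Matrix.fromBlocks_apply₂₁, Matrix.fromRows_apply_inr, Matrix.zero_apply, Matrix.zero_apply]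
  · rw [Matrix.fromBlocks_apply₂₂, Matrix.fromRows_apply_inr, Matrix.zero_apply, Matrix.zero_apply]

omit [Fintype ν] [Fintype μ] in
/-- [folklore] **THE SECOND GENERATOR OPERATOR** `G₂ a l` (`G₂ a l m j = X₂ l j m a`) under the single-row convention: for `l = inl t` the
one-entry diagonal `fromBlocks (diagonal fun i ↦ [i = t]·Nt t a) 0 0 0`, for `l = inr m` zero — packaged as one formula. -/
theorem G₂_singleRow (Nt : ν → ρ → ℝ) (x₁ : ν ⊕ μ → Matrix ν ρ ℝ) (hx : ∀ k i a, x₁ k i a = if Sum.inl i = k then Nt i a else 0)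
    (X₂ : ν ⊕ μ → ν ⊕ μ → Matrix (ν ⊕ μ) ρ ℝ) (hX₂ : ∀ k l, X₂ k l = if k = l then fromRows (x₁ k) (0 : Matrix μ ρ ℝ) else 0)
    (a : ρ) (l m j : ν ⊕ μ) :
    (Matrix.fromBlocks (Matrix.diagonal fun i : ν => if Sum.inl i = l then Nt i a else 0) 0 0 (0 : Matrix μ μ ℝ)) m j = X₂ l j m a := by
  rw [hX₂]
  rcases m with m | m <;> rcases j with j | j
  · rw [Matrix.fromBlocks_apply₁₁, Matrix.diagonal_apply]
    by_cases h : l = Sum.inl j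
    · subst h
      rw [if_pos rfl, Matrix.fromRows_apply_inl, hx]
      by_cases hmj : m = j
      · subst hmj; simp
      · rw [if_neg hmj, if_neg (fun e => hmj (Sum.inl_injective e))]
    · rw [if_neg h, Matrix.zero_apply]
      by_cases hmj : m = j
      · subst hmj; rw [if_pos rfl, if_neg (Ne.symm h)]
      · rw [if_neg hmj]
  · rw [Matrix.fromBlocks_apply₁₂, Matrix.zero_apply]
    by_cases h : l = Sum.inr j
    · subst h
      rw [if_pos rfl, Matrix.fromRows_apply_inl, hx, if_neg (by simp)]
    · rw [if_neg h, Matrix.zero_apply]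
  · rw [Matrix.fromBlocks_apply₂₁, Matrix.zero_apply]
    split_ifs
    · rw [Matrix.fromRows_apply_inr, Matrix.zero_apply]
    · rw [Matrix.zero_apply]
  · rw [Matrix.fromBlocks_apply₂₂, Matrix.zero_apply]
    split_ifs
    · rw [Matrix.fromRows_apply_inr, Matrix.zero_apply]
    · rw [Matrix.zero_apply]

omit [Fintype ν] [Fintype μ] in
/-- [folklore] **THE COMPONENT HESSIANS OF THE GENERATORS** `H a i` (`H a i j k = X₂ j k i a`) under the single-row convention: for `i = inl i′` the
one-entry diagonal at `i′`, for `i = inr m` zero — one formula. -/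
theorem H_singleRow (Nt : ν → ρ → ℝ) (x₁ : ν ⊕ μ → Matrix ν ρ ℝ) (hx : ∀ k i a, x₁ k i a = if Sum.inl i = k then Nt i a else 0)
    (X₂ : ν ⊕ μ → ν ⊕ μ → Matrix (ν ⊕ μ) ρ ℝ) (hX₂ : ∀ k l, X₂ k l = if k = l then fromRows (x₁ k) (0 : Matrix μ ρ ℝ) else 0)
    (a : ρ) (i j k : ν ⊕ μ) :
    (Matrix.fromBlocks (Matrix.diagonal fun i' : ν => if Sum.inl i' = i then Nt i' a else 0) 0 0 (0 : Matrix μ μ ℝ)) j k = X₂ j k i a := by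
  rw [hX₂]
  rcases j with j | j <;> rcases k with k | k
  · rw [Matrix.fromBlocks_apply₁₁, Matrix.diagonal_apply]
    by_cases hjk : j = k
    · subst hjk
      rw [if_pos rfl, if_pos rfl]
      rcases i with i | i
      · rw [Matrix.fromRows_apply_inl, hx]
        simp only [Sum.inl.injEq]
        by_cases h : j = i
        · subst h; simp
        · rw [if_neg h, if_neg (Ne.symm h)]
      · rw [Matrix.fromRows_apply_inr, Matrix.zero_apply, if_neg (by simp)]
    · rw [if_neg hjk, if_neg (fun e => hjk (Sum.inl_injective e)), Matrix.zero_apply]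
  · rw [Matrix.fromBlocks_apply₁₂, Matrix.zero_apply, if_neg (by simp), Matrix.zero_apply]
  · rw [Matrix.fromBlocks_apply₂₁, Matrix.zero_apply, if_neg (by simp), Matrix.zero_apply]
  · rw [Matrix.fromBlocks_apply₂₂, Matrix.zero_apply]
    split_ifs
    · rcases i with i | i
      · rw [Matrix.fromRows_apply_inl, hx, if_neg (by simp)]
      · rw [Matrix.fromRows_apply_inr, Matrix.zero_apply]
    · rw [Matrix.zero_apply]

omit [DecidableEq μ] in
/-- [folklore] **[C1] PACKED FROM ITS TWO BLOCKS.**  With `D_a := diagonal (Nt · a)`, the block identities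
(C1-K) `Σ_b W₀ b a • K₁ (inl b) = −(D_a·K₀ + K₀·D_a)` and (C1-Q) `Σ_b W₀ b a • Q₁ (inl b) = −Q₀·D_a` are EXACTLY the congruence-form law [C1]
`Σ_i Ŵ₀ i a • 𝕄₁ i = −((G a)ᵀ·𝕄₀ + 𝕄₀·G a)` for the packed data `𝕄₁ k = kkt (K₁ k) (Q₁ k)`, `𝕄₀ = kkt K₀ Q₀`, `Ŵ₀ = [W₀; 0]`,
`G a = fromBlocks D_a 0 0 0` (the multiplier-direction tables carry weight `0`). -/
theorem C1_packed_of_blocks (K₀ : Matrix ν ν ℝ) (Q₀ : Matrix μ ν ℝ) (K₁ : ν ⊕ μ → Matrix ν ν ℝ) (Q₁ : ν ⊕ μ → Matrix μ ν ℝ)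
    (W₀ : Matrix ν ρ ℝ) (Nt : ν → ρ → ℝ)
    (hCK : ∀ a, ∑ b, W₀ b a • K₁ (Sum.inl b) = -(Matrix.diagonal (fun i => Nt i a) * K₀ + K₀ * Matrix.diagonal (fun i => Nt i a)))
    (hCQ : ∀ a, ∑ b, W₀ b a • Q₁ (Sum.inl b) = -(Q₀ * Matrix.diagonal (fun i => Nt i a))) (a : ρ) :
    ∑ i, (fromRows W₀ (0 : Matrix μ ρ ℝ)) i a • kkt (K₁ i) (Q₁ i)
      = -((Matrix.fromBlocks (Matrix.diagonal fun i : ν => Nt i a) 0 0 (0 : Matrix μ μ ℝ))ᵀ * kkt K₀ Q₀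
          + kkt K₀ Q₀ * Matrix.fromBlocks (Matrix.diagonal fun i : ν => Nt i a) 0 0 (0 : Matrix μ μ ℝ)) := by
  rw [Fintype.sum_sum_type]
  simp only [Matrix.fromRows_apply_inl, Matrix.fromRows_apply_inr, Matrix.zero_apply, zero_smul, Finset.sum_const_zero, add_zero]
  rw [sum_smul_kkt, hCK a, hCQ a, kkt, kkt, Matrix.fromBlocks_transpose, Matrix.fromBlocks_multiply, Matrix.fromBlocks_multiply,
    Matrix.fromBlocks_add, Matrix.fromBlocks_neg]
  simp only [Matrix.diagonal_transpose, Matrix.transpose_zero, Matrix.zero_mul, Matrix.mul_zero, add_zero, zero_add,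
    Matrix.transpose_mul, Matrix.transpose_neg, neg_zero]

/-- [folklore] **«WARD-L WITH SOURCES», ORDER ONE, FROM THE CONGRUENCE LETTERS.**  (C1-K) ∧ (C1-Q) ∧ slot symmetry of the packed first tables ⟹
the K-letter with source and the exact Q-letter of `wardSrc₁`, for every fine direction. -/
theorem wardSrc₁_of_congruence (K₀ : Matrix ν ν ℝ) (Q₀ : Matrix μ ν ℝ) (K₁ : ν ⊕ μ → Matrix ν ν ℝ) (Q₁ : ν ⊕ μ → Matrix μ ν ℝ)
    (W₀ : Matrix ν ρ ℝ) (Nt : ν → ρ → ℝ) (x₁ : ν ⊕ μ → Matrix ν ρ ℝ) (hx : ∀ k i a, x₁ k i a = if Sum.inl i = k then Nt i a else 0)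
    (hCK : ∀ a, ∑ b, W₀ b a • K₁ (Sum.inl b) = -(Matrix.diagonal (fun i => Nt i a) * K₀ + K₀ * Matrix.diagonal (fun i => Nt i a)))
    (hCQ : ∀ a, ∑ b, W₀ b a • Q₁ (Sum.inl b) = -(Q₀ * Matrix.diagonal (fun i => Nt i a)))
    (hslot : ∀ k j i, kkt (K₁ k) (Q₁ k) j i = kkt (K₁ i) (Q₁ i) j k) (s : ν) :
    K₁ (Sum.inl s) * W₀ + K₀ * x₁ (Sum.inl s) = -Matrix.of (fun j a => K₀ j s * Nt j a)
      ∧ Q₁ (Sum.inl s) * W₀ + Q₀ * x₁ (Sum.inl s) = 0 :=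
  wardSrc₁ K₀ Q₀ K₁ Q₁ W₀ Nt x₁ hx (fun k => P1_of_congruence (kkt K₀ Q₀) (fun k => kkt (K₁ k) (Q₁ k)) (fromRows W₀ 0)
    (fun k => fromRows (x₁ k) 0) (fun a => Matrix.fromBlocks (Matrix.diagonal fun i : ν => Nt i a) 0 0 (0 : Matrix μ μ ℝ))
    (G_singleRow Nt x₁ hx) (C1_packed_of_blocks K₀ Q₀ K₁ Q₁ W₀ Nt hCK hCQ) hslot k) s

/-- [folklore] **«WARD-L WITH SOURCES», ORDER TWO, FROM THE CONGRUENCE LETTERS** — [C1] in blocks and [C2] in `P2_of_congruence`'s packed form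
with THE CONVENTION's generator operators (`G_singleRow`, `G₂_singleRow`, `H_singleRow`), slot symmetries of both packed tables ⟹ `wardSrc₂`'s
letters for all fine pairs (`X₂ k l = X₂ l k` is automatic for `[k = l]•X₁ k`). -/
theorem wardSrc₂_of_congruence (K₀ : Matrix ν ν ℝ) (Q₀ : Matrix μ ν ℝ) (K₁ : ν ⊕ μ → Matrix ν ν ℝ) (Q₁ : ν ⊕ μ → Matrix μ ν ℝ)
    (K₂ : ν → ν → Matrix ν ν ℝ) (Q₂ : ν → ν → Matrix μ ν ℝ) (W₀ : Matrix ν ρ ℝ)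
    (Nt : ν → ρ → ℝ) (x₁ : ν ⊕ μ → Matrix ν ρ ℝ) (hx : ∀ k i a, x₁ k i a = if Sum.inl i = k then Nt i a else 0)
    (𝕄₂ : ν ⊕ μ → ν ⊕ μ → Matrix (ν ⊕ μ) (ν ⊕ μ) ℝ) (h𝕄₂ : ∀ s t : ν, 𝕄₂ (Sum.inl s) (Sum.inl t) = kkt (K₂ s t) (Q₂ s t))
    (X₂ : ν ⊕ μ → ν ⊕ μ → Matrix (ν ⊕ μ) ρ ℝ) (hX₂ : ∀ k l, X₂ k l = if k = l then fromRows (x₁ k) (0 : Matrix μ ρ ℝ) else 0)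
    (hC2 : ∀ (a : ρ) (l : ν ⊕ μ), ∑ i, (fromRows W₀ (0 : Matrix μ ρ ℝ)) i a • 𝕄₂ i l + ∑ i, (fromRows (x₁ l) (0 : Matrix μ ρ ℝ)) i a • kkt (K₁ i) (Q₁ i)
      = -((Matrix.fromBlocks (Matrix.diagonal fun i : ν => if Sum.inl i = l then Nt i a else 0) 0 0 (0 : Matrix μ μ ℝ))ᵀ * kkt K₀ Q₀
          + kkt K₀ Q₀ * Matrix.fromBlocks (Matrix.diagonal fun i : ν => if Sum.inl i = l then Nt i a else 0) 0 0 (0 : Matrix μ μ ℝ))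
        - ((Matrix.fromBlocks (Matrix.diagonal fun i : ν => Nt i a) 0 0 (0 : Matrix μ μ ℝ))ᵀ * kkt (K₁ l) (Q₁ l)
          + kkt (K₁ l) (Q₁ l) * Matrix.fromBlocks (Matrix.diagonal fun i : ν => Nt i a) 0 0 (0 : Matrix μ μ ℝ))
        - ∑ i, kkt K₀ Q₀ i l • Matrix.fromBlocks (Matrix.diagonal fun i' : ν => if Sum.inl i' = i then Nt i' a else 0) 0 0 (0 : Matrix μ μ ℝ))
    (hslot₁ : ∀ k j i, kkt (K₁ k) (Q₁ k) j i = kkt (K₁ i) (Q₁ i) j k) (hslot₂ : ∀ i l j k, 𝕄₂ i l j k = 𝕄₂ k l j i) (s t : ν) :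
    K₂ s t * W₀ + K₁ (Sum.inl s) * x₁ (Sum.inl t) + K₁ (Sum.inl t) * x₁ (Sum.inl s) + K₀ * (if s = t then x₁ (Sum.inl s) else 0)
        = -Matrix.of (fun j a => (K₁ (Sum.inl t) j s + (if j = t then K₀ t s else 0) + (if j = s then K₀ s t else 0)) * Nt j a)
      ∧ Q₂ s t * W₀ + Q₁ (Sum.inl s) * x₁ (Sum.inl t) + Q₁ (Sum.inl t) * x₁ (Sum.inl s) + Q₀ * (if s = t then x₁ (Sum.inl s) else 0) = 0 := by
  have hX₂sym : ∀ k l, X₂ k l = X₂ l k := by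
    intro k l
    rw [hX₂, hX₂]
    by_cases h : k = l
    · subst h; rfl
    · rw [if_neg h, if_neg (Ne.symm h)]
  exact wardSrc₂ K₀ Q₀ K₁ Q₁ K₂ Q₂ W₀ Nt x₁ hx 𝕄₂ h𝕄₂ X₂ hX₂ (fun k l => P2_of_congruence (kkt K₀ Q₀) (fun k => kkt (K₁ k) (Q₁ k)) 𝕄₂
    (fromRows W₀ 0) (fun k => fromRows (x₁ k) 0) X₂ (fun a => Matrix.fromBlocks (Matrix.diagonal fun i : ν => Nt i a) 0 0 (0 : Matrix μ μ ℝ))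
    (fun a l => Matrix.fromBlocks (Matrix.diagonal fun i : ν => if Sum.inl i = l then Nt i a else 0) 0 0 (0 : Matrix μ μ ℝ))
    (fun a i => Matrix.fromBlocks (Matrix.diagonal fun i' : ν => if Sum.inl i' = i then Nt i' a else 0) 0 0 (0 : Matrix μ μ ℝ))
    (fun a m j => G_singleRow Nt x₁ hx a m j) (fun a l m j => G₂_singleRow Nt x₁ hx X₂ hX₂ a l m j)
    (fun a i j k => H_singleRow Nt x₁ hx X₂ hX₂ a i j k) hC2 hslot₁ hslot₂ hX₂sym k l) s t

end Congruence


end Summit.QuantumFields.BalabanUV.Beta.D1BFx.WardJetsSources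

end
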